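import Summits.QuantumAdvantage.QuantumAdvantage.Theses.CubicForrelation
import Literature.Computability.QuantumComplexity.PromiseClassesRel
import Literature.Computability.Complexity.CoinCounting

/-!
# Disproof of `pl_lift` (item stmt-QuantumAdvantage-0250, `PlLift`) — findings

Crux: `PlLift : BQP ⊆ BPP → PromiseBQP ⊆ PromiseBPP'` (route file `Theses/CubicForrelation.lean`,
shared verbatim with PromiseLift / CodeCarries / RandomOracleGauge / ExponentLadder / …).

FINDINGS (refuter-cdisprove-stmt-QuantumAdvantage-0250-0, 2026-08-15):

1. `not_plLift_iff` — **any refutation of the crux refutes the summit**: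
   `¬ PlLift ↔ (¬ QuantumAdvantage ∧ ¬ (PromiseBQP ⊆ PromiseBPP'))`. The crux is unrefutable short
   of proving `BQP ⊆ BPP` (Lean: sorry-free below). Conversely `PlLift ↔ (BQP ⊆ BPP ↔ PromiseBQP ⊆
   PromiseBPP')` (`plLift_iff_collapse_iff`): the converse lift is a theorem (`promise_collapse_imp`).
2. `not_semanticLiftSchema` — **the abstract lifting principle behind the crux is false**. Writing
   `LangOf 𝓜` / `PromOf 𝓜` for the language class and the promise class of a set `𝓜` of
   acceptance-probability maps, `BQP, PromiseBQP, BPP, PromiseBPP'` ARE `LangOf`/`PromOf` of the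
   quantum resp. probabilistic machines (`BQP_eq_langOf`, `PromiseBQP_eq_promOf`, `BPP_eq_langOf`,
   `PromiseBPP'_eq_promOf`), and `PlLift` is literally the instance
   `LangOf 𝓠 ⊆ LangOf 𝓡 → PromOf 𝓠 ⊆ PromOf 𝓡` (`plLift_iff_instance`); but the schema
   `∀ 𝓜₂ ⊆ 𝓜₁, LangOf 𝓜₁ ⊆ LangOf 𝓜₂ → PromOf 𝓜₁ ⊆ PromOf 𝓜₂` fails on a 3-point model
   (a machine with acceptance `1/2` somewhere decides no language but solves a promise problem —
   Goldreich's obstruction, made a theorem). Any proof of `PlLift` must use white-box structure of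
   uniform Clifford+T families / probabilistic TMs beyond their acceptance probabilities.
3. LANDED VOCABULARY (p68941, `Literature/Computability/QuantumComplexity/PromiseClassesRel.lean`):
   the relativized textbook promise classes `PromiseBQPRel A`, `PromiseBPP'Rel O` (+ sanity: trivial
   promises = `BQPRel`/`BPPRel`, empty oracle = `PromiseBQP`/`PromiseBPP'`, easy half of the lift at
   every oracle). §3 below types the relativized crux `PlLiftRel A` in them (imported).
4. **MAIN NEGATIVE RESULT — `PlLift` is FALSE relative to an oracle, so it has NO relativizing
   proof.** PROVED sorry-free with axioms {propext, Classical.choice, Quot.sound}: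
   `∃ A, BQPRel A ⊆ BPPRel (ofLanguage A) ∧ ¬ (PromiseBQPRel A ⊆ PromiseBPP'Rel (ofLanguage A))`,
   and even `∃ A, P^A = BQP^A ∧ PH^A infinite ∧ PromiseBQP^A ⊄ PromiseBPP'^A` (Aaronson–Arkhipov 2013
   §10 (10), p. 236: the Fortnow–Rogers world does NOT extend to `PromiseP = PromiseBQP`).
   World: `A = K ⊕ G`, `K = Cor37Brain.oracleK` (brain base of the tree's Fortnow–Rogers world), `G`
   Cohen generic for the FFKL collapse family ∪ the PH family ∪ countably many failure requirements.
   Files: evidence `PlLiftRelativized.lean` (item stmt-QuantumAdvantage-0250, 2026-08-15T22:44Z);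
   landed quantum side p68967 `Literature/Computability/QuantumComplexity/RazTalPrefixedMachine.lean`
   (`razTalPrefixed_bqpMachine`: Raz–Tal's `Q₁` reading the window at addresses `1·rtAddr`); barrier
   entry `Literature/Barriers/QuantumAdvantage/PromiseLiftRelativization.lean` (LANDED p69392 (after review-revise of p69159):
   `PromiseLiftRelativization.holds`, `not_relativizes_promiseLift`, `not_relativizes_promiseCollapse`,
   `not_PromiseBQPRel_subset_promiseLift` — route PromiseLift's #3 `PlPromiseIsLift` fails at the same
   oracle —, `relativizes_promiseLift_converse`, anchor `promiseLift_shape_empty_iff`).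
   CONSEQUENCE FOR PROVERS: any proof of `PlLift` (or of `PlPromiseIsLift` / `PlJonesExtends`) must be
   non-relativizing — it must use white-box structure of a specific `PromiseBQP`-complete problem;
   relativizing glue (promiseLift monotonicity, completeness under Karp reductions) cannot suffice.
5. WHY THE CRUX RESISTS REFUTATION: `not_plLift_iff` (item 1) — its negation is `BQP ⊆ BPP ∧
   PromiseBQP ⊄ PromiseBPP'`, i.e. the negation of the summit plus an unconditional separation of
   `P ≠ PSPACE` strength; the relativized world of item 4 shows this conjunction is CONSISTENT with
   every relativizing technique, which is the most a disprover can certify.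
-/

set_option linter.dupNamespace false

namespace Summit.QuantumAdvantage.QuantumAdvantage.Cruxes.pl_lift.Disproof

open Literature.Computability.Complexity Literature.Computability.Cryptography
open Summit.QuantumAdvantage.QuantumAdvantage.Theses.CubicForrelation (PlLift)

/-! ## §1 Propositional anatomy of the crux -/

/-- The summit gives the crux vacuously (false antecedent). [folklore] -/
theorem plLift_of_quantumAdvantage (h : QuantumAdvantage) : PlLift := by
  intro hc
  obtain ⟨L, hL, hLn⟩ := h
  exact absurd (hc hL) hLn

/-- The conclusion alone gives the crux. [folklore] -/
theorem plLift_of_promise_collapse (h : PromiseBQP ⊆ PromiseBPP') : PlLift := fun _ => h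

/-- **The converse lift is a theorem**: a promise collapse gives the language collapse (trivial
promises; `ofLanguage_mem_PromiseBQP_iff`, `ofLanguage_mem_PromiseBPP'_iff`).
[cite: Goldreich2006, §1.2] -/
theorem promise_collapse_imp (h : PromiseBQP ⊆ PromiseBPP') : BQP ⊆ BPP := by
  intro L hL
  have h1 : PromiseProblem.ofLanguage L ∈ PromiseBQP := ofLanguage_mem_PromiseBQP_iff.2 hL
  exact ofLanguage_mem_PromiseBPP'_iff.1 (h h1)

/-- `PlLift ↔ (S ∨ promise collapse)`. [folklore] -/
theorem plLift_iff : PlLift ↔ (QuantumAdvantage ∨ PromiseBQP ⊆ PromiseBPP') := by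
  constructor
  · intro h
    by_cases hS : QuantumAdvantage
    · exact Or.inl hS
    · refine Or.inr (h fun L hL => ?_)
      by_contra hLn
      exact hS ⟨L, hL, hLn⟩
  · rintro (h | h)
    exacts [plLift_of_quantumAdvantage h, plLift_of_promise_collapse h]

/-- **Refuting the crux refutes the summit and the promise collapse at once.** [folklore] -/
theorem not_plLift_iff : ¬ PlLift ↔ (¬ QuantumAdvantage ∧ ¬ (PromiseBQP ⊆ PromiseBPP')) := by
  rw [plLift_iff, not_or]

/-- In particular a disproof of the crux is a disproof of the summit `QuantumAdvantage`. [folklore] -/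
theorem not_quantumAdvantage_of_not_plLift (h : ¬ PlLift) : ¬ QuantumAdvantage :=
  (not_plLift_iff.1 h).1

/-- … and it would PROVE `BQP ⊆ BPP`. [folklore] -/
theorem BQP_subset_BPP_of_not_plLift (h : ¬ PlLift) : BQP ⊆ BPP := by
  intro L hL
  by_contra hLn
  exact (not_plLift_iff.1 h).1 ⟨L, hL, hLn⟩

/-- The crux says exactly that the two collapses are equivalent. [folklore] -/
theorem plLift_iff_collapse_iff : PlLift ↔ (BQP ⊆ BPP ↔ PromiseBQP ⊆ PromiseBPP') :=
  ⟨fun h => ⟨h, promise_collapse_imp⟩, fun h => h.1⟩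

/-! ## §2 The abstract (semantic) lifting schema is false

A "semantic machine" on an input type `X` is just its acceptance-probability map `m : X → ℝ`.
-/

section Schema

variable {X : Type}

/-- The languages decided with gap `(2/3, 1/3)` by some machine of `𝓜`. [cite: Goldreich2006, §1.2] -/
def LangOf (𝓜 : Set (X → ℝ)) : Set (Set X) :=
  {L | ∃ m ∈ 𝓜, ∀ x, (x ∈ L → 2 / 3 ≤ m x) ∧ (x ∉ L → m x ≤ 1 / 3)}

/-- The promise problems (yes, no) solved with gap `(2/3, 1/3)` ON THE PROMISE by some machine of
`𝓜`. [cite: Goldreich2006, Def. 1.2] -/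
def PromOf (𝓜 : Set (X → ℝ)) : Set (Set X × Set X) :=
  {Q | ∃ m ∈ 𝓜, (∀ x ∈ Q.1, 2 / 3 ≤ m x) ∧ (∀ x ∈ Q.2, m x ≤ 1 / 3)}

/-- **The semantic lifting schema**: for machine classes `𝓜₂ ⊆ 𝓜₁` (think: probabilistic ⊆
quantum machines), equality of the language classes lifts to the promise classes. [folklore] -/
def SemanticLiftSchema : Prop :=
  ∀ (X : Type) (𝓜₁ 𝓜₂ : Set (X → ℝ)), 𝓜₂ ⊆ 𝓜₁ → LangOf 𝓜₁ ⊆ LangOf 𝓜₂ → PromOf 𝓜₁ ⊆ PromOf 𝓜₂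

/-- The 3-point witness machine: accepts `0` surely, rejects `1` surely, is undecided on `2`. -/
private noncomputable def mHalf : Fin 3 → ℝ := fun i => if i = 0 then 1 else if i = 1 then 0 else 1 / 2

/-- **The semantic lifting schema is FALSE** (3-point model: `𝓜₂ =` the two constant machines,
`𝓜₁ = 𝓜₂ ∪ {mHalf}`; `mHalf` has no gap at the point `2`, so it decides no language and
`LangOf 𝓜₁ = LangOf 𝓜₂`, yet it solves the promise problem `({0}, {1})`, which no constant machine
does). This is Goldreich's obstruction "a promise machine has no gap off the promise" as a theorem:
`PlLift` does not follow from the language collapse by reasoning about acceptance probabilities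
alone. [cite: Goldreich2006, §1.2] [folklore] -/
theorem not_semanticLiftSchema : ¬ SemanticLiftSchema := by
  intro h
  classical
  let c0 : Fin 3 → ℝ := fun _ => 0
  let c1 : Fin 3 → ℝ := fun _ => 1
  let M2 : Set (Fin 3 → ℝ) := {c0, c1}
  let M1 : Set (Fin 3 → ℝ) := {mHalf, c0, c1}
  have hsub : M2 ⊆ M1 := by
    intro m hm
    simp only [M2, Set.mem_insert_iff, Set.mem_singleton_iff] at hm
    rcases hm with rfl | rfl <;> simp [M1]
  have hlang : LangOf M1 ⊆ LangOf M2 := by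
    rintro L ⟨m, hm, hL⟩
    simp only [M1, Set.mem_insert_iff, Set.mem_singleton_iff] at hm
    rcases hm with rfl | rfl | rfl
    · -- `mHalf` decides no language: look at the point `2`
      exfalso
      have h2 := hL 2
      by_cases hx : (2 : Fin 3) ∈ L
      · have := h2.1 hx; simp [mHalf] at this; norm_num at this
      · have := h2.2 hx; simp [mHalf] at this; norm_num at this
    · exact ⟨c0, by simp [M2], hL⟩
    · exact ⟨c1, by simp [M2], hL⟩
  have hQ : (({0}, {1}) : Set (Fin 3) × Set (Fin 3)) ∈ PromOf M1 := by
    refine ⟨mHalf, by simp [M1], ?_, ?_⟩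
    · intro x hx
      simp only [Set.mem_singleton_iff] at hx
      subst hx; norm_num [mHalf]
    · intro x hx
      simp only [Set.mem_singleton_iff] at hx
      subst hx; norm_num [mHalf]
  obtain ⟨m, hm, hyes, hno⟩ := h (Fin 3) M1 M2 hsub hlang hQ
  have h0 := hyes 0 rfl
  have h1 := hno 1 rfl
  simp only [M2, Set.mem_insert_iff, Set.mem_singleton_iff] at hm
  rcases hm with rfl | rfl
  · norm_num [c0] at h0
  · norm_num [c1] at h1

end Schema

/-! ### The crux IS an instance of the schema -/

/-- The acceptance-probability maps of uniform oracle-free Clifford+T families. [cite: Watrous2009, §III.2] -/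
def quantumMachines : Set (List Bool → ℝ) :=
  {m | ∃ F : QCircuitFamily cliffordT, F.IsOracleFree ∧ F.IsUniform ∧ m = fun x => F.acceptProbOn 0 x}

/-- The acceptance-probability maps of probabilistic polynomial-time machines (random-string form:
`L' ∈ P`, coin polynomial `p`). [cite: AroraBarak2009, Def. 7.3] -/
def probMachines : Set (List Bool → ℝ) :=
  {m | ∃ L' ∈ Classes.P, ∃ p : Polynomial ℕ,
    m = fun x => uniformProb (p.eval x.length) {y : List Bool | boolPair x y ∈ L'}}

/-- View a promise problem as a pair of sets. -/
def PromiseProblem.toPair (Q : PromiseProblem) : Set (List Bool) × Set (List Bool) := (Q.yes, Q.no)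

/-- `BQP = LangOf quantumMachines`. [cite: Watrous2009, §III.1] -/
theorem BQP_eq_langOf : BQP = LangOf quantumMachines := by
  ext L
  rw [ClassBQP.mem_BQP_iff]
  constructor
  · rintro ⟨F, hF, hU, h⟩
    exact ⟨_, ⟨F, hF, hU, rfl⟩, h⟩
  · rintro ⟨m, ⟨F, hF, hU, rfl⟩, h⟩
    exact ⟨F, hF, hU, h⟩

/-- `PromiseBQP = PromOf quantumMachines` (through `toPair`). [cite: Watrous2009, §III.2] -/
theorem PromiseBQP_eq_promOf (Q : PromiseProblem) :
    Q ∈ PromiseBQP ↔ PromiseProblem.toPair Q ∈ PromOf quantumMachines := by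
  constructor
  · rintro ⟨F, hF, hU, hy, hn⟩
    exact ⟨_, ⟨F, hF, hU, rfl⟩, hy, hn⟩
  · rintro ⟨m, ⟨F, hF, hU, rfl⟩, hy, hn⟩
    exact ⟨F, hF, hU, hy, hn⟩

/-- The "correct verdict" event of a language at an input inside the language. [folklore] -/
theorem setOf_iff_eq_of_mem {L' L : Language Bool} {x : List Bool} (hx : x ∈ L) :
    {y : List Bool | boolPair x y ∈ L' ↔ x ∈ L} = {y | boolPair x y ∈ L'} := by
  ext y; simp [hx]

/-- The "correct verdict" event of a language at an input outside the language. [folklore] -/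
theorem setOf_iff_eq_of_not_mem {L' L : Language Bool} {x : List Bool} (hx : x ∉ L) :
    {y : List Bool | boolPair x y ∈ L' ↔ x ∈ L} = {y | boolPair x y ∈ L'}ᶜ := by
  ext y; simp [hx]

/-- `BPP = LangOf probMachines` (the rejection probability is `1 −` acceptance,
`uniformProb_compl`). [cite: AroraBarak2009, Def. 7.3] -/
theorem BPP_eq_langOf : BPP = LangOf probMachines := by
  ext L
  change L ∈ bp Classes.P ↔ _
  constructor
  · rintro ⟨L', hL', p, h⟩
    refine ⟨_, ⟨L', hL', p, rfl⟩, fun x => ⟨fun hx => ?_, fun hx => ?_⟩⟩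
    · have := h x; rwa [setOf_iff_eq_of_mem hx] at this
    · have := h x
      rw [setOf_iff_eq_of_not_mem hx, uniformProb_compl] at this
      show uniformProb (p.eval x.length) {y | boolPair x y ∈ L'} ≤ 1 / 3
      linarith
  · rintro ⟨m, ⟨L', hL', p, rfl⟩, h⟩
    refine ⟨L', hL', p, fun x => ?_⟩
    by_cases hx : x ∈ L
    · rw [setOf_iff_eq_of_mem hx]; exact (h x).1 hx
    · rw [setOf_iff_eq_of_not_mem hx, uniformProb_compl]
      have : uniformProb (p.eval x.length) {y | boolPair x y ∈ L'} ≤ 1 / 3 := (h x).2 hx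
      linarith

/-- `PromiseBPP' = PromOf probMachines` (through `toPair`). [cite: Goldreich2006, Def. 1.2] -/
theorem PromiseBPP'_eq_promOf (Q : PromiseProblem) :
    Q ∈ PromiseBPP' ↔ PromiseProblem.toPair Q ∈ PromOf probMachines := by
  have hc : ∀ (L' : Language Bool) (x : List Bool),
      {y : List Bool | boolPair x y ∉ L'} = {y : List Bool | boolPair x y ∈ L'}ᶜ := fun L' x => rfl
  constructor
  · rintro ⟨L', hL', p, hy, hn⟩
    refine ⟨_, ⟨L', hL', p, rfl⟩, hy, fun x hx => ?_⟩
    have := hn x hx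
    rw [hc, uniformProb_compl] at this
    show uniformProb (p.eval x.length) {y | boolPair x y ∈ L'} ≤ 1 / 3
    linarith
  · rintro ⟨m, ⟨L', hL', p, rfl⟩, hy, hn⟩
    refine ⟨L', hL', p, hy, fun x hx => ?_⟩
    rw [hc, uniformProb_compl]
    have : uniformProb (p.eval x.length) {y | boolPair x y ∈ L'} ≤ 1 / 3 := hn x hx
    linarith

/-- **The crux is the instance `(quantumMachines, probMachines)` of the semantic lifting schema.**
Together with `not_semanticLiftSchema`: the crux cannot be proved "by monotonicity". [folklore] -/
theorem plLift_iff_instance :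
    PlLift ↔ (LangOf quantumMachines ⊆ LangOf probMachines →
      ∀ Q : PromiseProblem, PromiseProblem.toPair Q ∈ PromOf quantumMachines →
        PromiseProblem.toPair Q ∈ PromOf probMachines) := by
  rw [show PlLift = (BQP ⊆ BPP → PromiseBQP ⊆ PromiseBPP') from rfl, BQP_eq_langOf, BPP_eq_langOf]
  refine imp_congr Iff.rfl ⟨fun h Q hQ => ?_, fun h Q hQ => ?_⟩
  · exact (PromiseBPP'_eq_promOf Q).1 (h ((PromiseBQP_eq_promOf Q).2 hQ))
  · exact (PromiseBPP'_eq_promOf Q).2 (h Q ((PromiseBQP_eq_promOf Q).1 hQ))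

/-! ## §3 The relativized crux (vocabulary: the landed `PromiseClassesRel.lean`, p68941) -/

/-- The relativized promise lift at the oracle language `A`: the shape of the crux with every class
relativized (`BQPRel`, `BPPRel`, and the landed `PromiseBQPRel`, `PromiseBPP'Rel`); at `A = ∅` it
is `PlLift` (barrier file: `Literature.Barriers.QuantumAdvantage.promiseLift_shape_empty_iff`).
[folklore] -/
def PlLiftRel (A : Language Bool) : Prop :=
  BQPRel A ⊆ BPPRel (Oracle.ofLanguage A) →
    Literature.Computability.QuantumComplexity.PromiseBQPRel A ⊆
      Literature.Computability.QuantumComplexity.PromiseBPP'Rel (Oracle.ofLanguage A)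

/-- The converse relativized lift holds at every oracle (landed: `BQPRel_subset_BPPRel_of_promise`).
[cite: Goldreich2006, §1.2] -/
theorem plLiftRel_converse (A : Language Bool)
    (h : Literature.Computability.QuantumComplexity.PromiseBQPRel A ⊆
      Literature.Computability.QuantumComplexity.PromiseBPP'Rel (Oracle.ofLanguage A)) :
    BQPRel A ⊆ BPPRel (Oracle.ofLanguage A) :=
  Literature.Computability.QuantumComplexity.BQPRel_subset_BPPRel_of_promise h

/-- **Glue to the barrier statement**: an oracle with `BQP^A ⊆ BPP^A` and
`PromiseBQP^A ⊄ PromiseBPP'^A` is an oracle where `PlLiftRel` fails. [folklore] -/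
theorem exists_not_plLiftRel_of
    (h : ∃ A : Language Bool, BQPRel A ⊆ BPPRel (Oracle.ofLanguage A) ∧
      ¬ (Literature.Computability.QuantumComplexity.PromiseBQPRel A ⊆
          Literature.Computability.QuantumComplexity.PromiseBPP'Rel (Oracle.ofLanguage A))) :
    ∃ A : Language Bool, ¬ PlLiftRel A := by
  obtain ⟨A, h1, h2⟩ := h
  exact ⟨A, fun hl => h2 (hl h1)⟩

/-! ## §4 The relativized failure of the crux — see the LANDED barrier file

`Literature/Barriers/QuantumAdvantage/PromiseLiftRelativization.lean` (p69392):
`PromiseLiftRelativization.holds : ∃ A, BQPRel A ⊆ BPPRel (ofLanguage A) ∧ ¬ (PromiseBQPRel A ⊆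
PromiseBPP'Rel (ofLanguage A))`, whence `exists_not_plLiftRel_of PromiseLiftRelativization.holds :
∃ A, ¬ PlLiftRel A`; this published copy omits the import only because the farm had not yet built
that module when it was written (the evidence copy `Disproof.lean` v3 on the item has the import and
the corollaries `exists_not_plLiftRel`, `exists_P_eq_BQP_and_not_plLiftRel`). -/

end Summit.QuantumAdvantage.QuantumAdvantage.Cruxes.pl_lift.Disproof
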